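import Literature.AlgebraicGeometry.HodgeTheory.AlgebraicClassesCupOffRange
import Literature.AlgebraicGeometry.HodgeTheory.MotivatedClassesAssembly
import Literature.AlgebraicGeometry.HodgeTheory.SupportedClassesRationalProofs
import Literature.AlgebraicGeometry.HodgeTheory.AlgebraicClassesHodgeTypeHolds
import Literature.AlgebraicGeometry.HodgeTheory.HodgeTypeExteriorProduct
import Literature.AlgebraicGeometry.HodgeTheory.MotivatedClassesLefschetzRange
import Literature.AlgebraicGeometry.HodgeTheory.HardLefschetzNFoldHolds
import Literature.AlgebraicGeometry.HodgeTheory.LefschetzOneOneHolds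
import Literature.NumberTheory.Transcendental.DeRhamTheoremMultiplicative
import HarnessLib

/-!
# Line `motivated-anchor-split` (crux `HeckePrymWeil.SummitOffWeilSector`, stmt-HodgeConjecture-14374) — Stub 4: the unconditional range of `Nᵃ H²ᵃ ∪ Nᵇ H²ᵇ ⊆ Nᵃ⁺ᵇ H^{2(a+b)}`

The registered stub `stub_cupProductAlgebraic : Voisin2003_cupProduct_algebraicClasses` is the
multiplicativity of the coniveau carrier of algebraic classes `algebraicClasses V p = Nᵖ H²ᵖ(V(ℂ); ℂ)`
on every smooth projective complex `V` (C. Voisin, *Hodge Theory II*, Prop. 9.20, a theorem in print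
whose tree form is REDUCED to the moving of supports, `cupProduct_mem_algebraicClasses_of_moving`,
Chow's moving lemma + purity, for which there is deliberately no named fact). This file lands the
instances of the stub that hold unconditionally in the tree, in the stub's binder shape plus one
side condition, by two independent mechanisms:

* **no moving needed** (`AlgebraicClassesCupOffRange`): `a = 0 ∨ b = 0 ∨ d ≤ a + b`
  (`cupProduct_algebraicClasses_offRange`), whence `d ≤ 2` (`cupProduct_algebraicClasses_of_dim_le_two`);
* **Hodge theory instead of moving** (new here, `cupProduct_algebraicClasses_of_hodgeClasses_algebraic`):
  `Nᵖ H²ᵖ(V(ℂ); ℂ)` is the `ℂ`-span of its RATIONAL classes (`supportedClasses_le_span_isRationalClass`,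
  Grothendieck 1969), algebraic classes are of Hodge type `(p, p)`
  (`isOfHodgeType_of_mem_algebraicClasses_of_isSmoothProjective`, Voisin I Prop. 11.20), the cup
  product of rational classes is rational (`IsRationalClass.cup`) and adds Hodge types
  (`cupPreservesHodgeType_of_multiplicative_deRham` with de Rham's theorem
  `exists_deRhamIsoFamily_holds`, Voisin I Thm. 5.29 / §7.1.2); so by bilinearity of `∪` the
  bidegree-`(a, b)` case of Prop. 9.20 on `V` FOLLOWS FROM the Hodge conjecture on `V` in the single
  codimension `a + b`. The latter is a theorem of the tree in the Lefschetz range `d ≤ (a + b) + 1`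
  (`mem_algebraicClasses_of_lefschetzRange` fed with `lefschetzOneOne_rational_holds` and
  `nonempty_hardLefschetzNFold_holds`: Lefschetz `(1,1)` and hard Lefschetz, Voisin I Thm. 11.30 and
  Thm. 6.25) and for `d ≤ 3` in every codimension (`hodgeClasses_algebraic_of_dim_le_three_holds`,
  Voisin II proof of Prop. 10.26) — whence `cupProduct_algebraicClasses_of_dim_le_add_add_one`
  (all `d`, `d ≤ a + b + 1`; in particular DIVISOR ∪ DIVISOR on a threefold, `N¹ H² ∪ N¹ H² ⊆ N² H⁴`),
  `cupProduct_algebraicClasses_of_dim_le_three` (every bidegree on curves, surfaces and threefolds),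
  `cupProduct_algebraicClasses_of_closedRange` (the maximal unconditional range
  `a = 0 ∨ b = 0 ∨ d ≤ a + b + 1`), and `cupProduct_algebraicClasses_of_hodgeConjectureFor`.

What remains OPEN of the stub after this file is exactly the range `1 ≤ a`, `1 ≤ b`, `a + b + 2 ≤ d`
(so `d ≥ 4`; first case `(a, b) = (1, 1)` on a fourfold, landing in `H⁴` of a fourfold), and there it
is implied by (`cupProduct_algebraicClasses_of_hodgeClasses_algebraic_middleRange`) the Hodge conjecture
in the codimensions `2 ≤ p ≤ d - 2` — or, unconditionally in print, by the moving of supports.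

## References

* [VoisinHodgeII2003] C. Voisin, Hodge Theory and Complex Algebraic Geometry II (CUP 2003), §9.2.4
  Prop. 9.20; §10.2.3 proof of Prop. 10.26.
* [VoisinHodgeI2002] C. Voisin, Hodge Theory and Complex Algebraic Geometry I (CUP 2002), Thm. 5.29,
  §7.1.2, Thm. 6.25, Prop. 11.20, Thm. 11.30.
* [GrothendieckTopology1969] A. Grothendieck, Hodge's general conjecture is false for trivial reasons,
  Topology 8 (1969), pp. 299–300.
* [Fulton1998] W. Fulton, Intersection Theory, 2nd ed. (1998), §19.1–19.2.
-/

noncomputable section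

-- every declaration of this problem lives in `Summit.HodgeConjecture.HodgeConjecture.…` (summit = sub-problem)
set_option linter.dupNamespace false

open Literature.AlgebraicGeometry.Motives Literature.AlgebraicGeometry.HodgeTheory
  Literature.AlgebraicTopology.SingularHomology

namespace Summit.HodgeConjecture.HodgeConjecture.Theorems

/-! ### No moving needed: the off-range bidegrees and dimension `≤ 2` -/

/-- **Stub 4 of line `motivated-anchor-split` off the moving range**: for `V` smooth projective
complex of dimension `d`, `x ∈ Nᵃ H²ᵃ(V(ℂ); ℂ)`, `y ∈ Nᵇ H²ᵇ(V(ℂ); ℂ)` and `a = 0 ∨ b = 0 ∨ d ≤ a + b`,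
`x ∪ y ∈ Nᵃ⁺ᵇ H^{2(a+b)}(V(ℂ); ℂ)` (a degree-`0` factor needs no moving; in or above the top degree
every class is the class of a point or zero) — the tree's `cupProduct_mem_algebraicClasses_offRange`
in the stub's binder shape. [cite: VoisinHodgeII2003, §9.2.4 Prop. 9.20] -/
theorem cupProduct_algebraicClasses_offRange ⦃d : ℕ⦄ ⦃V : SchemeOver ℂ⦄ (hV : IsSmoothProjective d V)
    ⦃a b : ℕ⦄ (h : a = 0 ∨ b = 0 ∨ d ≤ a + b) ⦃x : complexBetti V (2 * a)⦄
    ⦃y : complexBetti V (2 * b)⦄ (hx : x ∈ algebraicClasses V a) (hy : y ∈ algebraicClasses V b) :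
    cupProduct (two_mul_add_two_mul a b) x y ∈ algebraicClasses V (a + b) :=
  cupProduct_mem_algebraicClasses_offRange hV h hx hy

/-- **Stub 4 of line `motivated-anchor-split` in dimension `≤ 2`**: for `V` smooth projective complex of
dimension `d ≤ 2`, `x ∈ Nᵃ H²ᵃ(V(ℂ); ℂ)` and `y ∈ Nᵇ H²ᵇ(V(ℂ); ℂ)` give `x ∪ y ∈ Nᵃ⁺ᵇ H^{2(a+b)}(V(ℂ); ℂ)`
— the `d ≤ 2` instance of the named fact `Voisin2003_cupProduct_algebraicClasses` (if `a, b ≥ 1` the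
product lands in or above the top degree, else a factor has degree `0`). [cite: VoisinHodgeII2003, §9.2.4 Prop. 9.20] -/
theorem cupProduct_algebraicClasses_of_dim_le_two ⦃d : ℕ⦄ ⦃V : SchemeOver ℂ⦄
    (hV : IsSmoothProjective d V) (hd : d ≤ 2) ⦃a b : ℕ⦄ ⦃x : complexBetti V (2 * a)⦄
    ⦃y : complexBetti V (2 * b)⦄ (hx : x ∈ algebraicClasses V a) (hy : y ∈ algebraicClasses V b) :
    cupProduct (two_mul_add_two_mul a b) x y ∈ algebraicClasses V (a + b) :=
  cupProduct_mem_algebraicClasses_of_dim_le_two hV hd a b hx hy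

/-! ### Hodge theory instead of moving: Prop. 9.20 on `V` in bidegree `(a, b)` from the Hodge conjecture on `V` in codimension `a + b` -/

/-- **The bidegree-`(a, b)` case of Voisin II Prop. 9.20 on the coniveau carrier of `V` follows from
the Hodge conjecture on `V` in codimension `a + b`.** For `V` smooth projective complex of dimension
`d`: if every rational class of Hodge type `(a + b, a + b)` in `H^{2(a+b)}(V(ℂ); ℂ)` lies in
`Nᵃ⁺ᵇ H^{2(a+b)}`, then `x ∈ Nᵃ H²ᵃ`, `y ∈ Nᵇ H²ᵇ ⟹ x ∪ y ∈ Nᵃ⁺ᵇ H^{2(a+b)}`. Proof: `Nᵖ H²ᵖ(V(ℂ); ℂ)`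
is the `ℂ`-span of its rational classes (`supportedClasses_le_span_isRationalClass`, Grothendieck:
`Filt'` with `ℂ`-coefficients is the complexification of the rational one), so by bilinearity of `∪`
(two `span_le` reductions through `Submodule.comap`) it suffices to treat `x`, `y` rational and
algebraic; such classes are of Hodge type `(a, a)`, `(b, b)` (Voisin I Prop. 11.20,
`isOfHodgeType_of_mem_algebraicClasses_of_isSmoothProjective`), their cup product is rational
(`IsRationalClass.cup`) of type `(a + b, a + b)` (Voisin I Thm. 5.29 with §7.1.2,
`cupPreservesHodgeType_of_multiplicative_deRham` and de Rham's theorem `exists_deRhamIsoFamily_holds`),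
hence algebraic by the hypothesis. [cite: VoisinHodgeI2002, §11.1.2 Prop. 11.20, §5.3.2 Thm. 5.29 and §7.1.2]
[cite: GrothendieckTopology1969, pp. 299–300] [cite: VoisinHodgeII2003, §9.2.4 Prop. 9.20] -/
theorem cupProduct_algebraicClasses_of_hodgeClasses_algebraic ⦃d : ℕ⦄ ⦃V : SchemeOver ℂ⦄
    (hV : IsSmoothProjective d V) ⦃a b : ℕ⦄
    (hHC : ∀ c : complexBetti V (2 * (a + b)), IsRationalClass c →
      IsOfHodgeType d V (2 * (a + b)) (a + b) (a + b) c → c ∈ algebraicClasses V (a + b))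
    ⦃x : complexBetti V (2 * a)⦄ ⦃y : complexBetti V (2 * b)⦄ (hx : x ∈ algebraicClasses V a)
    (hy : y ∈ algebraicClasses V b) :
    cupProduct (two_mul_add_two_mul a b) x y ∈ algebraicClasses V (a + b) := by
  -- the cup product of `V` adds Hodge types (de Rham's theorem, multiplicative form)
  have hcup : CupPreservesHodgeType d V :=
    cupPreservesHodgeType_of_multiplicative_deRham
      (fun E _ _ _ ↦ Literature.NumberTheory.Transcendental.exists_deRhamIsoFamily_holds E) hV
  -- (A) for `y` rational and algebraic, every algebraic `x` works
  have hA : ∀ ⦃y : complexBetti V (2 * b)⦄, IsRationalClass y → y ∈ algebraicClasses V b →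
      algebraicClasses V a ≤ (algebraicClasses V (a + b)).comap
        ((cupProduct (two_mul_add_two_mul a b)).flip y) := by
    intro y hyr hy
    refine (supportedClasses_le_span_isRationalClass hV (2 * a) a).trans ?_
    rw [Submodule.span_le]
    rintro x ⟨hxr, hx⟩
    rw [SetLike.mem_coe, Submodule.mem_comap, LinearMap.flip_apply]
    exact hHC _ (hxr.cup (two_mul_add_two_mul a b) hyr)
      (hcup (two_mul_add_two_mul a b)
        (isOfHodgeType_of_mem_algebraicClasses_of_isSmoothProjective hV a hx)
        (isOfHodgeType_of_mem_algebraicClasses_of_isSmoothProjective hV b hy))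
  -- (B) hence every algebraic `y` works
  have hB : algebraicClasses V b ≤ (algebraicClasses V (a + b)).comap
      (cupProduct (two_mul_add_two_mul a b) x) := by
    refine (supportedClasses_le_span_isRationalClass hV (2 * b) b).trans ?_
    rw [Submodule.span_le]
    rintro y ⟨hyr, hy⟩
    have hxy := hA hyr hy hx
    rw [Submodule.mem_comap, LinearMap.flip_apply] at hxy
    rw [SetLike.mem_coe, Submodule.mem_comap]
    exact hxy
  exact Submodule.mem_comap.mp (hB hy)

/-- **Prop. 9.20 on the coniveau carrier of `V`, in every bidegree, from the Hodge conjecture for `V`**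
(`HodgeConjectureFor d V`: every rational `(p, p)`-class on `V` is algebraic, all `p`): immediate from
`cupProduct_algebraicClasses_of_hodgeClasses_algebraic` at `p = a + b`. [cite: VoisinHodgeII2003, §9.2.4 Prop. 9.20]
[cite: VoisinHodgeI2002, §11.1.2 Prop. 11.20 and §7.1.2] -/
theorem cupProduct_algebraicClasses_of_hodgeConjectureFor ⦃d : ℕ⦄ ⦃V : SchemeOver ℂ⦄
    (hV : IsSmoothProjective d V) (hHC : HodgeConjectureFor d V) ⦃a b : ℕ⦄
    ⦃x : complexBetti V (2 * a)⦄ ⦃y : complexBetti V (2 * b)⦄ (hx : x ∈ algebraicClasses V a)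
    (hy : y ∈ algebraicClasses V b) :
    cupProduct (two_mul_add_two_mul a b) x y ∈ algebraicClasses V (a + b) :=
  cupProduct_algebraicClasses_of_hodgeClasses_algebraic hV (hHC.2 (a + b)) hx hy

/-! ### The unconditional instances: the Lefschetz range `d ≤ a + b + 1` and dimension `≤ 3` -/

/-- **`Nᵃ H²ᵃ ∪ Nᵇ H²ᵇ ⊆ Nᵃ⁺ᵇ H^{2(a+b)}` whenever `d ≤ a + b + 1`, unconditionally, in every dimension `d`.**
For `V` smooth projective complex of dimension `d ≤ a + b + 1`, `x ∈ Nᵃ H²ᵃ(V(ℂ); ℂ)` and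
`y ∈ Nᵇ H²ᵇ(V(ℂ); ℂ)` give `x ∪ y ∈ Nᵃ⁺ᵇ`: by `cupProduct_algebraicClasses_of_hodgeClasses_algebraic` it
suffices that rational `(a + b, a + b)`-classes on `V` be algebraic, which in the Lefschetz range of
codimensions `d ≤ (a + b) + 1` is the tree's `mem_algebraicClasses_of_lefschetzRange` (Lefschetz `(1,1)`,
`lefschetzOneOne_rational_holds`, transported by hard Lefschetz, `nonempty_hardLefschetzNFold_holds`;
Voisin I Thm. 11.30 and Thm. 6.25). New case beyond the off-range ones: `a, b ≥ 1`, `a + b = d - 1` —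
on a threefold, DIVISOR ∪ DIVISOR `N¹ H² ∪ N¹ H² ⊆ N² H⁴`. [cite: VoisinHodgeII2003, §9.2.4 Prop. 9.20 and §10.2.3 proof of Prop. 10.26]
[cite: VoisinHodgeI2002, Thm. 6.25 and Thm. 11.30] -/
theorem cupProduct_algebraicClasses_of_dim_le_add_add_one ⦃d : ℕ⦄ ⦃V : SchemeOver ℂ⦄
    (hV : IsSmoothProjective d V) ⦃a b : ℕ⦄ (h : d ≤ a + b + 1) ⦃x : complexBetti V (2 * a)⦄
    ⦃y : complexBetti V (2 * b)⦄ (hx : x ∈ algebraicClasses V a) (hy : y ∈ algebraicClasses V b) :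
    cupProduct (two_mul_add_two_mul a b) x y ∈ algebraicClasses V (a + b) :=
  cupProduct_algebraicClasses_of_hodgeClasses_algebraic hV
    (fun c hc hpp ↦ mem_algebraicClasses_of_lefschetzRange lefschetzOneOne_rational_holds
      (nonempty_hardLefschetzNFold_holds d V) hV (Or.inr h) c hc hpp) hx hy

/-- **Stub 4 of line `motivated-anchor-split` in dimension `≤ 3`, unconditionally**: for `V` smooth
projective complex of dimension `d ≤ 3` (curves, surfaces, threefolds), `x ∈ Nᵃ H²ᵃ(V(ℂ); ℂ)` and
`y ∈ Nᵇ H²ᵇ(V(ℂ); ℂ)` give `x ∪ y ∈ Nᵃ⁺ᵇ H^{2(a+b)}(V(ℂ); ℂ)` in EVERY bidegree `(a, b)`: by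
`cupProduct_algebraicClasses_of_hodgeClasses_algebraic` and the Hodge conjecture in every degree for
varieties of dimension `≤ 3` (`hodgeClasses_algebraic_of_dim_le_three_holds`: Lefschetz `(1,1)` and the
Lefschetz isomorphism `L : H² ≅ H⁴` of a threefold, Voisin II proof of Prop. 10.26). The only bidegree
not already off-range is `(1, 1)` on a threefold. [cite: VoisinHodgeII2003, §9.2.4 Prop. 9.20 and §10.2.3 proof of Prop. 10.26] -/
theorem cupProduct_algebraicClasses_of_dim_le_three ⦃d : ℕ⦄ ⦃V : SchemeOver ℂ⦄
    (hV : IsSmoothProjective d V) (hd : d ≤ 3) ⦃a b : ℕ⦄ ⦃x : complexBetti V (2 * a)⦄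
    ⦃y : complexBetti V (2 * b)⦄ (hx : x ∈ algebraicClasses V a) (hy : y ∈ algebraicClasses V b) :
    cupProduct (two_mul_add_two_mul a b) x y ∈ algebraicClasses V (a + b) :=
  cupProduct_algebraicClasses_of_hodgeClasses_algebraic hV
    (hodgeClasses_algebraic_of_dim_le_three_holds hd hV (a + b)) hx hy

/-- **The maximal unconditional range of Stub 4 in the tree**: for `V` smooth projective complex of
dimension `d`, `x ∈ Nᵃ H²ᵃ(V(ℂ); ℂ)`, `y ∈ Nᵇ H²ᵇ(V(ℂ); ℂ)` and `a = 0 ∨ b = 0 ∨ d ≤ a + b + 1`, the product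
`x ∪ y` lies in `Nᵃ⁺ᵇ H^{2(a+b)}(V(ℂ); ℂ)` (degree-`0` factors by `cupProduct_algebraicClasses_offRange`, the
rest by `cupProduct_algebraicClasses_of_dim_le_add_add_one`). The complementary range `1 ≤ a`, `1 ≤ b`,
`a + b + 2 ≤ d` is where Chow's moving lemma (or the Hodge conjecture in codimension `a + b` on `V`)
is needed. [cite: VoisinHodgeII2003, §9.2.4 Prop. 9.20] [cite: VoisinHodgeI2002, Thm. 6.25 and Thm. 11.30] -/
theorem cupProduct_algebraicClasses_of_closedRange ⦃d : ℕ⦄ ⦃V : SchemeOver ℂ⦄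
    (hV : IsSmoothProjective d V) ⦃a b : ℕ⦄ (h : a = 0 ∨ b = 0 ∨ d ≤ a + b + 1)
    ⦃x : complexBetti V (2 * a)⦄ ⦃y : complexBetti V (2 * b)⦄ (hx : x ∈ algebraicClasses V a)
    (hy : y ∈ algebraicClasses V b) :
    cupProduct (two_mul_add_two_mul a b) x y ∈ algebraicClasses V (a + b) := by
  rcases h with ha | hb | hd
  · exact cupProduct_algebraicClasses_offRange hV (Or.inl ha) hx hy
  · exact cupProduct_algebraicClasses_offRange hV (Or.inr (Or.inl hb)) hx hy
  · exact cupProduct_algebraicClasses_of_dim_le_add_add_one hV hd hx hy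

/-- **Registered sub-goal `stub_cupProductAlgebraic_closedRange` of Stub 4** (the stub
`stub_cupProductAlgebraic : Voisin2003_cupProduct_algebraicClasses` with the side condition
`a = 0 ∨ b = 0 ∨ d ≤ a + b + 1` inserted after the bidegree binders; proved, by
`cupProduct_algebraicClasses_of_closedRange`). [cite: VoisinHodgeII2003, §9.2.4 Prop. 9.20] -/
theorem stub_cupProductAlgebraic_closedRange :
    ∀ ⦃d : ℕ⦄ ⦃V : SchemeOver ℂ⦄, IsSmoothProjective d V → ∀ ⦃a b : ℕ⦄, a = 0 ∨ b = 0 ∨ d ≤ a + b + 1 →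
      ∀ ⦃x : complexBetti V (2 * a)⦄ ⦃y : complexBetti V (2 * b)⦄, x ∈ algebraicClasses V a →
        y ∈ algebraicClasses V b →
          cupProduct (two_mul_add_two_mul a b) x y ∈ algebraicClasses V (a + b) :=
  fun _ _ hV _ _ h _ _ hx hy ↦ cupProduct_algebraicClasses_of_closedRange hV h hx hy

/-! ### What remains: the stub from the Hodge conjecture in the middle codimensions `2 ≤ p ≤ d - 2` -/

/-- **The whole stub from the Hodge conjecture in the middle range of codimensions.** If on every
smooth projective complex `V` of dimension `d` every rational `(p, p)`-class with `2 ≤ p` and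
`p + 2 ≤ d` is algebraic, then `Voisin2003_cupProduct_algebraicClasses` holds: the bidegrees with
`a = 0 ∨ b = 0 ∨ d ≤ a + b + 1` are unconditional (`cupProduct_algebraicClasses_of_closedRange`), and in
the remaining range `1 ≤ a`, `1 ≤ b`, `a + b + 2 ≤ d` the codimension `p = a + b` is a middle one
(`cupProduct_algebraicClasses_of_hodgeClasses_algebraic`). This records precisely what is left of the
stub after the unconditional landings (in print it is instead Chow's moving lemma with purity,
Voisin II Lemma 9.22, that closes it). [cite: VoisinHodgeII2003, §9.2.4 Prop. 9.20 and Lemma 9.22]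
[cite: VoisinHodgeI2002, §11.3 Conj. 11.24] -/
theorem cupProduct_algebraicClasses_of_hodgeClasses_algebraic_middleRange
    (hmid : ∀ ⦃d : ℕ⦄ ⦃V : SchemeOver ℂ⦄, IsSmoothProjective d V → ∀ ⦃p : ℕ⦄, 2 ≤ p → p + 2 ≤ d →
      ∀ c : complexBetti V (2 * p), IsRationalClass c → IsOfHodgeType d V (2 * p) p p c →
        c ∈ algebraicClasses V p) :
    Voisin2003_cupProduct_algebraicClasses := by
  intro d V hV a b x y hx hy
  by_cases h : a = 0 ∨ b = 0 ∨ d ≤ a + b + 1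
  · exact cupProduct_algebraicClasses_of_closedRange hV h hx hy
  · have h2 : 2 ≤ a + b := by omega
    have hd : a + b + 2 ≤ d := by omega
    exact cupProduct_algebraicClasses_of_hodgeClasses_algebraic hV (hmid hV h2 hd) hx hy

end Summit.HodgeConjecture.HodgeConjecture.Theorems

end
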